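import Mathlib
import HarnessLib
import Summits.HubbardSuperconductivity.HubbardSuperconductivity.Theorems.KLProgrammeKLRegimeTwoVolumeSpineDataDefs
import Summits.HubbardSuperconductivity.HubbardSuperconductivity.Theorems.KLProgrammeKLRegimeTwoVolumeSubstitutionPushforwardWt

/-!
# Route `KLProgramme` — crux K3, VL child `KLRegimeVolumeLimitV17F2` (stmt-HubbardSuperconductivity-20440), blueprint v5 M5: THE TWO DERIVED ONE-VOLUME PROFILES
# OF A SCALE (seat hubbard-kl-k3c4-p1 g12; `--supports` 20440)

In the composition of the per-scale step (`…SrcSectorScaleSuccBundled`) with the fine-side frame composite (`…FrameComposite`) two of the one-volume profiles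
are NOT read off the engine but derived on the spot, each by ONE bounded operation from a fresh profile (no iteration across scales — memo RADIUS-g9):

* **`wtProfileRaw_effAction_of_wtProfileEven`** — the raw-degree `Λ`-weighted profile of the OUTPUT `effAction C⁺ V` of a scale from the even weighted profile
  of its input `V` and the scale's covariance bundle `ScaleCovData` (one weighted determinant-bounded step,
  `GrassmannWeightedEffectiveActionBoundDB.sum_wt_norm_kernel_effAction_le_of_gramBounded`, with the spectator lift of `…TwoVolumeDoubledData/SpectatorLegs`):
  this is the next scale's `hN𝒲` (coarse) and the input of the next item (fine); the unit partition function comes with it;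
* **`wtProfileEven_map_of_wtProfileRaw`** — the even `Λ`-weighted profile of the HYBRID re-analysis `map T 𝒲′` (frame-`K` transfer of the fine own-frame
  action) from the raw weighted profile of `𝒲′` and the transfer bundle `TransferWtData` (the diameter-weighted pushforward
  `…TwoVolumeSubstitutionPushforwardWt.sum_pinned_wt_norm_kernel_map_le`): MinS's `hNW′` and M3f's `hNW`.

Generic in the lattice sizes and sector counts; proofs only; no definition.
-/

noncomputable section

namespace Summit.HubbardSuperconductivity.HubbardSuperconductivity.Theorems.TwoVolumeDefect

set_option linter.dupNamespace false -- summit = problem name (single-conjunct summit), D-0017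

open Finset Literature.MathematicalPhysics.QuantumLattice GrassmannAlgebra Literature.Probability.LatticeModels
  Literature.Probability.LatticeModels.BattleFederbush
open Summit.HubbardSuperconductivity.HubbardSuperconductivity.Theorems.TwoPointAssembly

/-- **THE OUTPUT PROFILE OF A SCALE BY ONE WEIGHTED DETERMINANT-BOUNDED STEP**: for the spectator lift `C⁺` of a covariance with bundle `ScaleCovData C Λ κ αW sW`
and an even input `V` without constant part with even `Λ`-weighted profile `NV`, under `θ₀ = e·αW·‖NV‖/κ² < 1`: the partition function is a unit and
`effAction C⁺ V` has the raw-degree `Λ`-weighted profile `k ↦ ρ₀⁻ᵏ·e‖NV‖/(1−θ₀)`. [cite: BenfattoGiulianiMastropietro2006, (2.77)-(2.80); folklore: spectator lift] -/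
theorem wtProfileRaw_effAction_of_wtProfileEven {L M N : ℕ} [NeZero L] [LinearOrder ((SpaceTimeIdx L M × SectorLeg N) × Fin 2)]
    (CL : Matrix (SpaceTimeIdx L M × SectorLeg N) (SpaceTimeIdx L M × SectorLeg N) ℂ)
    (Cd : Matrix ((SpaceTimeIdx L M × SectorLeg N) × Fin 2) ((SpaceTimeIdx L M × SectorLeg N) × Fin 2) ℂ)
    (hCd : ∀ p q, Cd p q = if p.2 = 0 ∧ q.2 = 0 then CL p.1 q.1 else 0)
    {Λ κ αW sW : ℝ} (hΛ : 0 ≤ Λ) (hC : ScaleCovData CL Λ κ αW sW)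
    (V : GrassmannAlgebra ℂ ((SpaceTimeIdx L M × SectorLeg N) × Fin 2)) (hVe : V ∈ evenOdd ℂ 0) (hV0 : constPart ℂ V = 0)
    {NV : ℕ → ℝ} (hNV : WtProfileEven V Λ NV) {ρ₀ : ℝ} (hρ₀ : 0 < ρ₀)
    (hθ₀ : Real.exp 1 * αW * normV ((SpaceTimeIdx L M × SectorLeg N) × Fin 2) κ ρ₀ NV / κ ^ 2 < 1) :
    IsUnit (effPartitionFn ℂ Cd V) ∧
      WtProfileRaw (effAction ℂ Cd V) Λ (fun k => ρ₀⁻¹ ^ k * (Real.exp 1 * normV ((SpaceTimeIdx L M × SectorLeg N) × Fin 2) κ ρ₀ NV) /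
        (1 - Real.exp 1 * αW * normV ((SpaceTimeIdx L M × SectorLeg N) × Fin 2) κ ρ₀ NV / κ ^ 2)) := by
  set dc : ((SpaceTimeIdx L M × SectorLeg N) × Fin 2) → ((SpaceTimeIdx L M × SectorLeg N) × Fin 2) → ℝ :=
    fun Y₁ Y₂ => Λ * (Torus.tnorm (Y₁.1.1.2 - Y₂.1.1.2) : ℝ) with hdc_def
  have hdc : IsLabelDist dc := isLabelDist_mul_of_nonneg hΛ (isLabelDist_tnorm_sectorSite.comap (fun Y : ((SpaceTimeIdx L M × SectorLeg N) × Fin 2) => Y.1))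
  have hwt : IsTreeWeight (diamWeight (fun t : ℝ => 1 + t) dc) :=
    isTreeWeight_diamWeight hdc (fun s hs => by linarith) (fun s t _ hst => by linarith) (fun s t hs ht => by nlinarith)
  have hGBd : IsGramBoundedR Cd κ := isGramBoundedR_spectator CL Cd hCd hC.gram
  have hVe' : V ∈ evenPart ℂ ((SpaceTimeIdx L M × SectorLeg N) × Fin 2) := (mem_evenPart_iff).2 hVe
  have hpair : ∀ X Y : ((SpaceTimeIdx L M × SectorLeg N) × Fin 2), diamWeight (fun t : ℝ => 1 + t) dc {X, Y} = 1 + Λ * (Torus.tnorm (X.1.1.2 - Y.1.1.2) : ℝ) :=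
    fun X Y => by rw [diamWeight_pair hdc]
  have hrowd : ∀ X, ∑ Y, ‖Cd X Y‖ * diamWeight (fun t : ℝ => 1 + t) dc {X, Y} ≤ αW := by
    intro X; simp only [hpair]
    exact sum_norm_spectatorCov_mul_row_le CL Cd hCd (fun Y : ((SpaceTimeIdx L M × SectorLeg N) × Fin 2) => 1 + Λ * (Torus.tnorm (X.1.1.2 - Y.1.1.2) : ℝ)) X
      hC.αW_pos.le (hC.row X.1)
  have hcold : ∀ Y, ∑ X, ‖Cd X Y‖ * diamWeight (fun t : ℝ => 1 + t) dc {X, Y} ≤ αW := by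
    intro Y; simp only [hpair]
    exact sum_norm_spectatorCov_mul_col_le CL Cd hCd (fun X : ((SpaceTimeIdx L M × SectorLeg N) × Fin 2) => 1 + Λ * (Torus.tnorm (X.1.1.2 - Y.1.1.2) : ℝ)) Y
      hC.αW_pos.le (hC.col Y.1)
  have hNVd : ∀ m' (j : Fin (2 * m')) (x : ((SpaceTimeIdx L M × SectorLeg N) × Fin 2)),
      ∑ Y ∈ univ.filter (fun Y : Fin (2 * m') → ((SpaceTimeIdx L M × SectorLeg N) × Fin 2) => Y j = x),
        ‖kernel ℂ V (2 * m') Y‖ * diamWeight (fun t : ℝ => 1 + t) dc (univ.image Y) ≤ NV m' :=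
    fun m' j x => hNV.le m' j x
  obtain ⟨hZ, hstep⟩ := sum_wt_norm_kernel_effAction_le_of_gramBounded (C := Cd) hwt hC.κ_pos hGBd _ hVe' hV0 NV hNV.nonneg hNVd hC.αW_pos hrowd hcold hρ₀ hθ₀
  have hθ₀' : 0 < 1 - Real.exp 1 * αW * normV ((SpaceTimeIdx L M × SectorLeg N) × Fin 2) κ ρ₀ NV / κ ^ 2 := sub_pos.2 hθ₀
  refine ⟨hZ, ⟨fun k => ?_, fun k p y => ?_⟩⟩
  · exact div_nonneg (mul_nonneg (pow_nonneg (inv_nonneg.2 hρ₀.le) _)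
      (mul_nonneg (Real.exp_pos 1).le (normV_nonneg hC.κ_pos.le hρ₀.le hNV.nonneg))) hθ₀'.le
  · rcases Nat.eq_zero_or_pos k with h0 | hpos
    · subst h0; exact absurd p.2 (by omega)
    · exact le_trans (le_of_eq (sum_congr rfl fun Y _ => mul_comm _ _)) (hstep hpos p y)

/-- **THE HYBRID RE-ANALYSIS PROFILE BY ONE WEIGHTED PUSHFORWARD**: for a doubled transfer `T` with bundle `TransferWtData T ed ed₁ ΛT cW` and an action `𝒲′`
with raw `Λ₁`-weighted profile `NW`, at any rate `Λ ≤ min(ΛT, Λ₁)`: `map (toLin' T) 𝒲′` has the even `Λ`-weighted profile `m′ ↦ cW^{2m′−1}·(cW·NW(2m′))`.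
[cite: BenfattoGiulianiMastropietro2006, (2.71a); folklore: diameter-weighted pushforward] -/
theorem wtProfileEven_map_of_wtProfileRaw {b L Lf M N N₁ : ℕ} [NeZero L] [NeZero Lf]
    (T : Matrix ((SpaceTimeIdx Lf M × SectorLeg N) × Fin 2) ((SpaceTimeIdx Lf M × SectorLeg N₁) × Fin 2) ℂ)
    (ed : ((SpaceTimeIdx Lf M × SectorLeg N) × Fin 2) ≃ (Fin 2 → Fin b) × ((SpaceTimeIdx L M × SectorLeg N) × Fin 2))
    (ed₁ : ((SpaceTimeIdx Lf M × SectorLeg N₁) × Fin 2) ≃ (Fin 2 → Fin b) × ((SpaceTimeIdx L M × SectorLeg N₁) × Fin 2))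
    {ΛT cW : ℝ} (hTr : TransferWtData T ed ed₁ ΛT cW) {Λ Λ₁ : ℝ} (hΛ : 0 ≤ Λ) (hΛT : Λ ≤ ΛT) (hΛ₁ : Λ ≤ Λ₁)
    (𝒲' : GrassmannAlgebra ℂ ((SpaceTimeIdx Lf M × SectorLeg N₁) × Fin 2)) {NW : ℕ → ℝ} (hW : WtProfileRaw 𝒲' Λ₁ NW) :
    WtProfileEven (ExteriorAlgebra.map (Matrix.toLin' T) 𝒲') Λ (fun m' => cW ^ (2 * m' - 1) * (cW * NW (2 * m'))) := by
  -- the three distances: output labels at rate `Λ`, input labels at rate `Λ₁`, cross at rate `Λ`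
  set d₂ : ((SpaceTimeIdx Lf M × SectorLeg N) × Fin 2) → ((SpaceTimeIdx Lf M × SectorLeg N) × Fin 2) → ℝ :=
    fun x x' => Λ * (Torus.tnorm (x.1.1.2 - x'.1.1.2) : ℝ) with hd₂
  set d₁ : ((SpaceTimeIdx Lf M × SectorLeg N₁) × Fin 2) → ((SpaceTimeIdx Lf M × SectorLeg N₁) × Fin 2) → ℝ :=
    fun y y' => Λ₁ * (Torus.tnorm (y.1.1.2 - y'.1.1.2) : ℝ) with hd₁
  set dc : ((SpaceTimeIdx Lf M × SectorLeg N) × Fin 2) → ((SpaceTimeIdx Lf M × SectorLeg N₁) × Fin 2) → ℝ :=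
    fun x y => Λ * (Torus.tnorm (x.1.1.2 - y.1.1.2) : ℝ) with hdc
  have hd₂L : IsLabelDist d₂ := isLabelDist_mul_of_nonneg hΛ (isLabelDist_tnorm_sectorSite.comap (fun Y : ((SpaceTimeIdx Lf M × SectorLeg N) × Fin 2) => Y.1))
  have hdc0 : ∀ x y, 0 ≤ dc x y := fun x y => by rw [hdc]; positivity
  have htn : ∀ s t : TorusSite 2 Lf, (Torus.tnorm (s - t) : ℝ) = Torus.tnorm (t - s) := fun s t => by
    rw [← neg_sub, Torus.tnorm_neg]
  have htri : ∀ s t u : TorusSite 2 Lf, (Torus.tnorm (s - u) : ℝ) ≤ Torus.tnorm (s - t) + Torus.tnorm (t - u) := by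
    intro s t u
    have h := Torus.tnorm_add_le (s - t) (t - u)
    rw [sub_add_sub_cancel] at h
    exact_mod_cast h
  have hcross : ∀ x x' y y', d₂ x x' ≤ dc x y + d₁ y y' + dc x' y' := by
    intro x x' y y'
    simp only [hd₂, hd₁, hdc]
    have h1 := htri x.1.1.2 y.1.1.2 x'.1.1.2
    have h2 := htri y.1.1.2 y'.1.1.2 x'.1.1.2
    have h3 := htn y'.1.1.2 x'.1.1.2
    have h0 : (0 : ℝ) ≤ Torus.tnorm (y.1.1.2 - y'.1.1.2) := Nat.cast_nonneg _
    nlinarith [mul_le_mul_of_nonneg_right hΛ₁ h0]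
  -- the transfer rows/columns at rate `Λ ≤ Λ_T`
  have hwle : ∀ (x : (SpaceTimeIdx Lf M × SectorLeg N) × Fin 2) (y' : (SpaceTimeIdx Lf M × SectorLeg N₁) × Fin 2),
      ‖T x y'‖ * (1 + dc x y') ≤ ‖T x y'‖ * (1 + ΛT * (Torus.tnorm (x.1.1.2 - y'.1.1.2) : ℝ)) := fun x y' =>
    mul_le_mul_of_nonneg_left (by simp only [hdc]; gcongr) (norm_nonneg _)
  have hcol : ∀ y', ∑ x', ‖T x' y'‖ * (1 + dc x' y') ≤ cW := fun y' => (sum_le_sum fun x' _ => hwle x' y').trans (hTr.col y')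
  have hrow : ∀ x, ∑ y', ‖T x y'‖ * (1 + dc x y') ≤ cW := fun x => (sum_le_sum fun y' _ => hwle x y').trans (hTr.row x)
  -- every positive degree
  have haux : ∀ (k : ℕ), 0 < k → ∀ (p : Fin k) (x : (SpaceTimeIdx Lf M × SectorLeg N) × Fin 2),
      ∑ Y ∈ univ.filter (fun Y : Fin k → (SpaceTimeIdx Lf M × SectorLeg N) × Fin 2 => Y p = x),
        ‖kernel ℂ (ExteriorAlgebra.map (Matrix.toLin' T) 𝒲') k Y‖ * (1 + labelDiam d₂ (univ.image Y)) ≤ cW ^ (k - 1) * (cW * NW k) := by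
    intro k hk p x
    obtain ⟨n, rfl⟩ := Nat.exists_eq_add_one_of_ne_zero hk.ne'
    have h := sum_pinned_wt_norm_kernel_map_le (𝕜 := ℂ) T 𝒲' p x (d₁ := d₁) hd₂L hdc0 hcross (phi := fun t : ℝ => 1 + t) (fun s hs => by linarith)
      (fun s t _ hst => by linarith) (fun s t hs ht => by nlinarith) hTr.cW_nonneg (hW.nonneg (n + 1)) hcol (hrow x) (fun y' => hW.le (n + 1) p y')
    rw [Nat.add_sub_cancel]
    exact h
  refine ⟨fun m' => mul_nonneg (pow_nonneg hTr.cW_nonneg _) (mul_nonneg hTr.cW_nonneg (hW.nonneg _)), fun m' j x => ?_⟩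
  exact haux (2 * m') j.pos j x

end Summit.HubbardSuperconductivity.HubbardSuperconductivity.Theorems.TwoVolumeDefect

end
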